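import Mathlib
import Summits.ResolutionOfSingularities.ResolutionOfSingularities.Theses.TropicalLinks

/-!
# TropicalLinks / InductiveStep — BC2-redirect SPLIT assembly (crux-strategist, 2026-08-17)

Route `ResolutionOfSingularities/TropicalLinks`, deciding crux `InductiveStep`
(`stmt-ResolutionOfSingularities-17233`; by strong induction it is Tevelev's schön-open conjecture in
characteristic `p` in Gröbner form, i.e. summit-strength). This file proves, sorry-free, the typed
decomposition

  `RegularProjectiveClosure → SncBoundaryClosure → SncClosureSchon → InductiveStep`

whose three hypotheses are, VERBATIM, the one-line statements of the three children installed by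
`ledger route edit route-ResolutionOfSingularities-TropicalLinks --split InductiveStep` (so that the
split can cite this theorem with `--glue-by`). All three are statements of pure commutative algebra
about a prime ideal `I ⊆ k[x₁^±,…,x_N^±]` (`k` algebraically closed of characteristic `p`), a Laurent
polynomial `g ∉ I`, the coordinate ring `A_g = (k[x^±]/I)[g⁻¹]` of the principal open `U_g ⊆ U = V(I)`
and an affine embedding `f : Fin n → A_g` (generators of `A_g`): the PROJECTIVE CLOSURE of
`U_g ↪ 𝔸ⁿ ⊆ ℙⁿ` is described chart by chart — chart `0` is `A_g`, chart `i+1` (`x_{i+1} ≠ 0`) is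
`k[X₀,…,X_n] ⧸ ker (X₀ ↦ 1/fᵢ, X_{j+1} ↦ fⱼ/fᵢ)` (a subring of `A_g[1/fᵢ]`), and the hyperplane at
infinity has local equation the class of `X₀`.

* `RegularProjectiveClosure` (child 1, crux): some `U_g` has an affine embedding with REGULAR projective
  closure (weak, morphism-free resolution: a regular projective model in which a principal affine open
  is the complement of a hyperplane section). Open in dimension `≥ 4`.
* `SncBoundaryClosure` (child 2, crux): if some `U_g` has a regular projective closure then some `U_{g'}`
  has one whose hyperplane at infinity is a STRICT NORMAL CROSSINGS divisor (Stacks 0BI9, local form) —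
  weak embedded resolution of the boundary. Open in dimension `≥ 4`.
* `SncClosureSchon` (child 3, support, KNOWN and characteristic-free: Luxton–Qu, arXiv:0902.2009,
  Prop. 3.1 and the proof of Thm. 1.4 run with the very ample `𝒪(m·H_∞)` — whose sections restrict to
  regular FUNCTIONS on `U_g`, so the schön open is principal —, Tevelev 2007 Thm. 1.4, the Gröbner
  dictionary Helm–Katz 2012 Prop. 3.9, and the reduction to the intrinsic torus): a regular projective
  closure with snc hyperplane at infinity yields Laurent polynomials `G_j ∉ I` such that the re-embedded
  principal open `U[G⁻¹] ⊆ 𝔾_m^{N+m}` has ALL initial degenerations regular (the conclusion of `SchonAt`).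

The proof is logic (`∃`-eliminations and one application; the induction hypothesis of `InductiveStep`
is not needed — `InductiveStep` is equivalent to `SchonPlus`): the mathematical content of the
redirect is in the children, each strictly a CONSEQUENCE of Tevelev's conjecture (tropical
compactification in a smooth projective toric variety gives both), neither of the two open ones
implying it or the summit on its own.
-/

namespace Summit.ResolutionOfSingularities.ResolutionOfSingularities.Theorems

open scoped BigOperators Topology Manifold Classical MeasureTheory ProbabilityTheory Matrix InnerProductSpace ComplexConjugate ContinuousMap
open Filter Set Function TopologicalSpace MeasureTheory

set_option maxHeartbeats 400000 in
/-- **Split assembly for `TropicalLinks.InductiveStep`** (BC2 redirect): regular projective closures of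
principal opens (`RegularProjectiveClosure`) + strict-normal-crossings boundaries for such closures
(`SncBoundaryClosure`) + the Luxton–Qu/Tevelev passage from an snc-compactified principal open to a
schön principal re-embedding (`SncClosureSchon`) imply the inductive step of the route, hence (route
file, `closes`) Tevelev's schön-open conjecture in characteristic `p` and resolution. The three
hypotheses are verbatim the children statements of the split. Pure logic. [folklore] -/
theorem tropicalLinks_inductiveStep_of_subs
    (h1 : ∀ p : ℕ, p.Prime → ∀ (k : Type) [Field k] [CharP k p] [IsAlgClosed k] (N : ℕ) (I : Ideal (AddMonoidAlgebra k (Fin N → ℤ))), I.IsPrime → ∃ g ∉ I, ∃ (n : ℕ) (f : Fin n → Localization.Away (Ideal.Quotient.mk I g)), (Function.Surjective (MvPolynomial.aeval f : MvPolynomial (Fin n) k →ₐ[k] Localization.Away (Ideal.Quotient.mk I g)) ∧ (∀ (P : Ideal (Localization.Away (Ideal.Quotient.mk I g))) [P.IsPrime], IsRegularLocalRing (Localization.AtPrime P)) ∧ ∀ (i : Fin n) (P : Ideal (MvPolynomial (Fin (n + 1)) k ⧸ RingHom.ker (MvPolynomial.aeval (Fin.cons (IsLocalization.Away.invSelf (f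 i)) (fun j => algebraMap (Localization.Away (Ideal.Quotient.mk I g)) (Localization.Away (f i)) (f j) * IsLocalization.Away.invSelf (f i)) : Fin (n + 1) → Localization.Away (f i)) : MvPolynomial (Fin (n + 1)) k →ₐ[k] Localization.Away (f i)))) [P.IsPrime], IsRegularLocalRing (Localization.AtPrime P)))
    (h2 : ∀ p : ℕ, p.Prime → ∀ (k : Type) [Field k] [CharP k p] [IsAlgClosed k] (N : ℕ) (I : Ideal (AddMonoidAlgebra k (Fin N → ℤ))), I.IsPrime → ∀ g ∉ I, ∀ (n : ℕ) (f : Fin n → Localization.Away (Ideal.Quotient.mk I g)), (Function.Surjective (MvPolynomial.aeval f : MvPolynomial (Fin n) k →ₐ[k] Localization.Away (Ideal.Quotient.mk I g)) ∧ (∀ (P : Ideal (Localization.Away (Ideal.Quotient.mk I g))) [P.IsPrime], IsRegularLocalRing (Localization.AtPrime P)) ∧ ∀ (i : Fin n) (P : Ideal (MvPolynomial (Fin (n + 1)) k ⧸ RingHom.ker (MvPolynomial.aeval (Fin.cons (IsLocalization.Away.invSelf (f i)) (fun j => algebraMap (Localization.Away (Ideal.Quotient.mk I g)) (Localization.Away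 (f i)) (f j) * IsLocalization.Away.invSelf (f i)) : Fin (n + 1) → Localization.Away (f i)) : MvPolynomial (Fin (n + 1)) k →ₐ[k] Localization.Away (f i)))) [P.IsPrime], IsRegularLocalRing (Localization.AtPrime P)) → ∃ g' ∉ I, ∃ (n' : ℕ) (f' : Fin n' → Localization.Away (Ideal.Quotient.mk I g')), (Function.Surjective (MvPolynomial.aeval f' : MvPolynomial (Fin n') k →ₐ[k] Localization.Away (Ideal.Quotient.mk I g')) ∧ (∀ (P : Ideal (Localization.Away (Ideal.Quotient.mk I g'))) [P.IsPrime], IsRegularLocalRing (Localization.AtPrime P)) ∧ ∀ (i : Fin n') (P : Ideal (MvPolynomial (Fin (n' + 1)) k ⧸ RingHom.ker (MvPolynomial.aeval (Fin.cons (IsLocalization.Away.invSelf (f' i)) (fun j => algebraMap (Localization.Away (Ideal.Quotient.mk I g')) (Localization.Away (f' i)) (f' j) * IsLocalization.Away.invSelf (f' i)) : Fin (n' + 1) → Localization.Away (f' i)) : MvPolynomial (Fin (n' + 1)) k →ₐ[k] Localization.Away (f' i)))) [P.IsPrime], IsRegularLocalRing (Localization.AtPrime P)) ∧ (∀ (i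 : Fin n') (P : Ideal (MvPolynomial (Fin (n' + 1)) k ⧸ RingHom.ker (MvPolynomial.aeval (Fin.cons (IsLocalization.Away.invSelf (f' i)) (fun j => algebraMap (Localization.Away (Ideal.Quotient.mk I g')) (Localization.Away (f' i)) (f' j) * IsLocalization.Away.invSelf (f' i)) : Fin (n' + 1) → Localization.Away (f' i)) : MvPolynomial (Fin (n' + 1)) k →ₐ[k] Localization.Away (f' i)))) [P.IsPrime], (Ideal.Quotient.mk (RingHom.ker (MvPolynomial.aeval (Fin.cons (IsLocalization.Away.invSelf (f' i)) (fun j => algebraMap (Localization.Away (Ideal.Quotient.mk I g')) (Localization.Away (f' i)) (f' j) * IsLocalization.Away.invSelf (f' i)) : Fin (n' + 1) → Localization.Away (f' i)) : MvPolynomial (Fin (n' + 1)) k →ₐ[k] Localization.Away (f' i))) (MvPolynomial.X 0) : (MvPolynomial (Fin (n' + 1)) k ⧸ RingHom.ker (MvPolynomial.aeval (Fin.cons (IsLocalization.Away.invSelf (f' i)) (fun j => algebraMap (Localization.Away (Ideal.Quotient.mk I g')) (Localization.Away (f' i)) (f' j) * IsLocalization.Away.invSelf (f' i)) : Fin (n'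 + 1) → Localization.Away (f' i)) : MvPolynomial (Fin (n' + 1)) k →ₐ[k] Localization.Away (f' i)))) ∈ P → ∃ (r e : ℕ) (x : Fin r → Localization.AtPrime P) (y : Fin e → Localization.AtPrime P), 1 ≤ r ∧ ringKrullDim (Localization.AtPrime P) = ((r + e : ℕ) : WithBot ℕ∞) ∧ Ideal.span (Set.range x ∪ Set.range y) = IsLocalRing.maximalIdeal (Localization.AtPrime P) ∧ (Ideal.span {algebraMap (MvPolynomial (Fin (n' + 1)) k ⧸ RingHom.ker (MvPolynomial.aeval (Fin.cons (IsLocalization.Away.invSelf (f' i)) (fun j => algebraMap (Localization.Away (Ideal.Quotient.mk I g')) (Localization.Away (f' i)) (f' j) * IsLocalization.Away.invSelf (f' i)) : Fin (n' + 1) → Localization.Away (f' i)) : MvPolynomial (Fin (n' + 1)) k →ₐ[k] Localization.Away (f' i))) (Localization.AtPrime P) (Ideal.Quotient.mk (RingHom.ker (MvPolynomial.aeval (Fin.cons (IsLocalization.Away.invSelf (f' i)) (fun j => algebraMap (Localization.Away (Ideal.Quotient.mk I g')) (Localization.Away (f' i)) (f' j) * IsLocalization.Away.invSelf (f' i)) :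 Fin (n' + 1) → Localization.Away (f' i)) : MvPolynomial (Fin (n' + 1)) k →ₐ[k] Localization.Away (f' i))) (MvPolynomial.X 0) : (MvPolynomial (Fin (n' + 1)) k ⧸ RingHom.ker (MvPolynomial.aeval (Fin.cons (IsLocalization.Away.invSelf (f' i)) (fun j => algebraMap (Localization.Away (Ideal.Quotient.mk I g')) (Localization.Away (f' i)) (f' j) * IsLocalization.Away.invSelf (f' i)) : Fin (n' + 1) → Localization.Away (f' i)) : MvPolynomial (Fin (n' + 1)) k →ₐ[k] Localization.Away (f' i))))}).radical = Ideal.span {∏ l, x l}))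
    (h3 : ∀ p : ℕ, p.Prime → ∀ (k : Type) [Field k] [CharP k p] [IsAlgClosed k] (N : ℕ) (I : Ideal (AddMonoidAlgebra k (Fin N → ℤ))), I.IsPrime → ∀ g ∉ I, ∀ (n : ℕ) (f : Fin n → Localization.Away (Ideal.Quotient.mk I g)), (Function.Surjective (MvPolynomial.aeval f : MvPolynomial (Fin n) k →ₐ[k] Localization.Away (Ideal.Quotient.mk I g)) ∧ (∀ (P : Ideal (Localization.Away (Ideal.Quotient.mk I g))) [P.IsPrime], IsRegularLocalRing (Localization.AtPrime P)) ∧ ∀ (i : Fin n) (P : Ideal (MvPolynomial (Fin (n + 1)) k ⧸ RingHom.ker (MvPolynomial.aeval (Fin.cons (IsLocalization.Away.invSelf (f i)) (fun j => algebraMap (Localization.Away (Ideal.Quotient.mk I g)) (Localization.Away (f i)) (f j) * IsLocalization.Away.invSelf (f i)) : Fin (n + 1) → Localization.Away (f i)) : MvPolynomial (Fin (n + 1)) k →ₐ[k] Localization.Away (f i)))) [P.IsPrime], IsRegularLocalRing (Localization.AtPrime P)) → (∀ (i : Fin n) (P : Ideal (MvPolynomial (Fin (n + 1)) k ⧸ RingHom.ker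 (MvPolynomial.aeval (Fin.cons (IsLocalization.Away.invSelf (f i)) (fun j => algebraMap (Localization.Away (Ideal.Quotient.mk I g)) (Localization.Away (f i)) (f j) * IsLocalization.Away.invSelf (f i)) : Fin (n + 1) → Localization.Away (f i)) : MvPolynomial (Fin (n + 1)) k →ₐ[k] Localization.Away (f i)))) [P.IsPrime], (Ideal.Quotient.mk (RingHom.ker (MvPolynomial.aeval (Fin.cons (IsLocalization.Away.invSelf (f i)) (fun j => algebraMap (Localization.Away (Ideal.Quotient.mk I g)) (Localization.Away (f i)) (f j) * IsLocalization.Away.invSelf (f i)) : Fin (n + 1) → Localization.Away (f i)) : MvPolynomial (Fin (n + 1)) k →ₐ[k] Localization.Away (f i))) (MvPolynomial.X 0) : (MvPolynomial (Fin (n + 1)) k ⧸ RingHom.ker (MvPolynomial.aeval (Fin.cons (IsLocalization.Away.invSelf (f i)) (fun j => algebraMap (Localization.Away (Ideal.Quotient.mk I g)) (Localization.Away (f i)) (f j) * IsLocalization.Away.invSelf (f i)) : Fin (n + 1) → Localization.Away (f i)) : MvPolynomial (Fin (n + 1)) k →ₐ[k] Localization.Away (f i)))) ∈ P → ∃ (r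 e : ℕ) (x : Fin r → Localization.AtPrime P) (y : Fin e → Localization.AtPrime P), 1 ≤ r ∧ ringKrullDim (Localization.AtPrime P) = ((r + e : ℕ) : WithBot ℕ∞) ∧ Ideal.span (Set.range x ∪ Set.range y) = IsLocalRing.maximalIdeal (Localization.AtPrime P) ∧ (Ideal.span {algebraMap (MvPolynomial (Fin (n + 1)) k ⧸ RingHom.ker (MvPolynomial.aeval (Fin.cons (IsLocalization.Away.invSelf (f i)) (fun j => algebraMap (Localization.Away (Ideal.Quotient.mk I g)) (Localization.Away (f i)) (f j) * IsLocalization.Away.invSelf (f i)) : Fin (n + 1) → Localization.Away (f i)) : MvPolynomial (Fin (n + 1)) k →ₐ[k] Localization.Away (f i))) (Localization.AtPrime P) (Ideal.Quotient.mk (RingHom.ker (MvPolynomial.aeval (Fin.cons (IsLocalization.Away.invSelf (f i)) (fun j => algebraMap (Localization.Away (Ideal.Quotient.mk I g)) (Localization.Away (f i)) (f j) * IsLocalization.Away.invSelf (f i)) : Fin (n + 1) → Localization.Away (f i)) : MvPolynomial (Fin (n + 1)) k →ₐ[k] Localization.Away (f i))) (MvPolynomial.X 0) : (MvPolynomial (Fin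 (n + 1)) k ⧸ RingHom.ker (MvPolynomial.aeval (Fin.cons (IsLocalization.Away.invSelf (f i)) (fun j => algebraMap (Localization.Away (Ideal.Quotient.mk I g)) (Localization.Away (f i)) (f j) * IsLocalization.Away.invSelf (f i)) : Fin (n + 1) → Localization.Away (f i)) : MvPolynomial (Fin (n + 1)) k →ₐ[k] Localization.Away (f i))))}).radical = Ideal.span {∏ l, x l}) → ∃ (m : ℕ) (G : Fin m → AddMonoidAlgebra k (Fin N → ℤ)), (∀ j, G j ∉ I) ∧ ∀ (w : Fin (N + m) → ℤ) (P : Ideal (AddMonoidAlgebra k (Fin (N + m) → ℤ) ⧸ Ideal.span ((fun f : AddMonoidAlgebra k (Fin (N + m) → ℤ) => AddMonoidAlgebra.ofCoeff (f.coeff.filter fun v => ∀ u ∈ f.coeff.support, ∑ i, w i * v i ≤ ∑ i, w i * u i)) '' (↑(Ideal.span ((fun f : AddMonoidAlgebra k (Fin N → ℤ) => (AddMonoidAlgebra.ofCoeff (f.coeff.mapDomain fun v => Fin.append v (0 : Fin m → ℤ)) : AddMonoidAlgebra k (Fin (N + m) → ℤ))) '' (↑I : Set (AddMonoidAlgebra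 k (Fin N → ℤ))) ∪ Set.range (fun j : Fin m => AddMonoidAlgebra.single (Fin.append (0 : Fin N → ℤ) (Pi.single j (1 : ℤ))) (1 : k) - AddMonoidAlgebra.ofCoeff ((G j).coeff.mapDomain fun v => Fin.append v (0 : Fin m → ℤ))))) : Set (AddMonoidAlgebra k (Fin (N + m) → ℤ)))))) [P.IsPrime], IsRegularLocalRing (Localization.AtPrime P)) :
    Summit.ResolutionOfSingularities.ResolutionOfSingularities.Theses.TropicalLinks.InductiveStep := by
  intro p hp d _
  beta_reduce
  intro k _ _ _ N I hI _
  obtain ⟨g, hg, n, f, hreg⟩ := h1 p hp k N I hI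
  obtain ⟨g', hg', n', f', hreg', hsnc⟩ := h2 p hp k N I hI g hg n f hreg
  exact h3 p hp k N I hI g' hg' n' f' hreg' hsnc

end Summit.ResolutionOfSingularities.ResolutionOfSingularities.Theorems
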